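/-
Copyright (c) 2026. All rights reserved.
Released under Apache 2.0 license as described in the file LICENSE.
-/
import Literature.AlgebraicGeometry.HodgeTheory.HodgeFiltrationModelsRigidity
import Literature.Geometry.Manifold.NaturalCohomologyEndo
import Literature.AlgebraicTopology.SingularHomology.CohomologyClopenPieces

/-!
# Rigidity of natural de Rham comparisons — discharge of `NaturalDeRhamComparisonRigidity`

`Literature.AlgebraicGeometry.HodgeTheory.NaturalDeRhamComparisonRigidity`
(`HodgeFiltrationModelsReduction.lean`): two natural complex de Rham comparison families `e`
(over the manifolds charted on `E`) and `e'` (over those charted on `E'`), read on a compact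
manifold `M` through a diffeomorphism `h : M ≃ M'`, differ in each degree by a scalar.

## Proof

If `M` is empty everything vanishes. Otherwise the differential of `h` at a point is a real
linear isomorphism `L : E ≃L[ℝ] E'`; re-charting along `L` (`Literature.Geometry.Manifold.Rechart`)
turns every `E`-manifold `N` into an `E'`-manifold `N_L` with the same underlying space, and
`ψ_N := into^* ∘ e'_{N_L} ∘ out^*_dR ∘ e_N⁻¹` is a natural endomorphism of `Hᵏ(-; ℂ)` on
`E`-manifolds (`transportNatEndo`; naturality of `e`, `e'` and functoriality of both pull-backs).
By `Literature.Geometry.Manifold.NaturalCohomologyEndo.exists_eq_smul` (Morse theory: natural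
endomorphisms of `Hᵏ(-; F)` are scalars on compact manifolds) `ψ_M = r`, and unwinding with the
naturality of `e'` along the `C^∞` map `h ∘ out : M_L → M'` gives
`h^* (e'_{M'} y) = r • e_M (h^*_dR y)`.

Consequently the hub fact `hodgePQ_independent_of_hodgeModel` (`HodgeFiltrationModels.lean`) is a
theorem: `hodgePQ_independent_of_hodgeModel_holds`.

## References
* C. Voisin, *Hodge Theory and Complex Algebraic Geometry I* (2002), §7.3.2.
* J. Milnor, *Morse theory* (1963), §3, §5; *Lectures on the h-cobordism theorem* (1965).
* A. Hatcher, *Algebraic Topology* (2002), §3.1.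
-/

noncomputable section

open scoped Manifold ContDiff
open CategoryTheory Function
open Literature.NumberTheory.Transcendental (ComplexDeRhamIsoFamily complexDeRhamCohomology
  PullbackFacts)
open Literature.AlgebraicTopology.SingularHomology (singularCohomology)
open Literature.Geometry.Manifold (Rechart NaturalCohomologyEndo)

namespace Literature.AlgebraicGeometry.HodgeTheory

/-! ### Transport of a comparison family along a linear change of model -/

section Transport

variable {E : Type} [NormedAddCommGroup E] [NormedSpace ℂ E]
  {E' : Type} [NormedAddCommGroup E'] [NormedSpace ℂ E'] (L : E ≃L[ℝ] E')

/-- The change of model `L : E ≃ₜ E'` is `C^∞`. [folklore] -/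
theorem contMDiff_linearHomeomorph : ContMDiff 𝓘(ℝ, E) 𝓘(ℝ, E') ∞ L.toHomeomorph :=
  Rechart.contMDiff_of_apply_eq_linear (I := 𝓘(ℝ, E)) L.toHomeomorph L fun _ ↦ rfl

/-- The inverse change of model is `C^∞`. [folklore] -/
theorem contMDiff_linearHomeomorph_symm : ContMDiff 𝓘(ℝ, E') 𝓘(ℝ, E) ∞ L.toHomeomorph.symm :=
  Rechart.contMDiff_symm_of_apply_eq_linear (I := 𝓘(ℝ, E)) L.toHomeomorph L fun _ ↦ rfl

/-- `N` re-charted on `E'` along `L` is a `C^∞` `E'`-manifold (a local instance in this file).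
[folklore] -/
theorem isManifold_rechart (N : Type) [TopologicalSpace N] [ChartedSpace E N]
    [IsManifold 𝓘(ℝ, E) ∞ N] : IsManifold 𝓘(ℝ, E') ∞ (Rechart L.toHomeomorph N) :=
  Rechart.isManifold _ _ (contMDiff_linearHomeomorph L) (contMDiff_linearHomeomorph_symm L)

attribute [local instance] isManifold_rechart

/-- The identity `N_L → N` is `C^∞`. [folklore] -/
theorem contMDiff_out (N : Type) [TopologicalSpace N] [ChartedSpace E N] [IsManifold 𝓘(ℝ, E) ∞ N] :
    ContMDiff 𝓘(ℝ, E') 𝓘(ℝ, E) ∞ (Rechart.out L.toHomeomorph N) :=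
  Rechart.contMDiff_out _ _ (contMDiff_linearHomeomorph L) (contMDiff_linearHomeomorph_symm L)

/-- The identity `N → N_L` is `C^∞`. [folklore] -/
theorem contMDiff_into (N : Type) [TopologicalSpace N] [ChartedSpace E N] [IsManifold 𝓘(ℝ, E) ∞ N] :
    ContMDiff 𝓘(ℝ, E) 𝓘(ℝ, E') ∞ (Rechart.into L.toHomeomorph N) :=
  Rechart.contMDiff_into _ _ (contMDiff_linearHomeomorph L) (contMDiff_linearHomeomorph_symm L)

variable (e : ComplexDeRhamIsoFamily E) (e' : ComplexDeRhamIsoFamily E') (k : ℕ)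

/-- **The transported endomorphism** `ψ_N = into^* ∘ e'_{N_L} ∘ out^*_dR ∘ e_N⁻¹` of `Hᵏ(N; ℂ)`
(the comparison `e'` read on `N` through the re-charting, against `e`). [folklore] -/
def transportEndo (N : Type) [TopologicalSpace N] [ChartedSpace E N] [IsManifold 𝓘(ℝ, E) ∞ N]
    [T2Space N] [SigmaCompactSpace N] :
    singularCohomology ℂ ℂ N k →ₗ[ℂ] singularCohomology ℂ ℂ N k :=
  (singularCohomology.map ℂ ℂ
      ⟨Rechart.into L.toHomeomorph N, Rechart.continuous_into _ _⟩ k).hom ∘ₗ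
    (e' (Rechart L.toHomeomorph N) k).toLinearMap ∘ₗ
      complexDeRhamCohomology.map E' (contMDiff_out L N) k ∘ₗ (e N k).symm.toLinearMap

/-- Unfolding `transportEndo`. [folklore] -/
theorem transportEndo_apply (N : Type) [TopologicalSpace N] [ChartedSpace E N]
    [IsManifold 𝓘(ℝ, E) ∞ N] [T2Space N] [SigmaCompactSpace N] (x : singularCohomology ℂ ℂ N k) :
    transportEndo L e e' k N x =
      singularCohomology.map ℂ ℂ ⟨Rechart.into L.toHomeomorph N, Rechart.continuous_into _ _⟩ k
        (e' (Rechart L.toHomeomorph N) k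
          (complexDeRhamCohomology.map E' (contMDiff_out L N) k ((e N k).symm x))) :=
  rfl

variable {e e'}

/-- **Naturality of the transported endomorphism** under `C^∞` maps of `E`-manifolds
(naturality of `e` and `e'`, functoriality of `f ↦ f^*` on de Rham and on singular cohomology).
[cite: BottTu1982Forms, §I.5] -/
theorem transportEndo_naturality (he : e.IsNatural) (he' : e'.IsNatural)
    (M : Type) [TopologicalSpace M] [ChartedSpace E M] [IsManifold 𝓘(ℝ, E) ∞ M] [T2Space M]
    [SigmaCompactSpace M] (N : Type) [TopologicalSpace N] [ChartedSpace E N]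
    [IsManifold 𝓘(ℝ, E) ∞ N] [T2Space N] [SigmaCompactSpace N] (f : M → N)
    (hf : ContMDiff 𝓘(ℝ, E) 𝓘(ℝ, E) ∞ f) (x : singularCohomology ℂ ℂ N k) :
    transportEndo L e e' k M (singularCohomology.map ℂ ℂ ⟨f, hf.continuous⟩ k x) =
      singularCohomology.map ℂ ℂ ⟨f, hf.continuous⟩ k (transportEndo L e e' k N x) := by
  set c := (e N k).symm x with hc
  have hx : x = e N k c := ((e N k).apply_symm_apply x).symm
  -- the re-charted map `f_L : M_L → N_L`
  have hfL : ContMDiff 𝓘(ℝ, E') 𝓘(ℝ, E') ∞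
      (fun z ↦ Rechart.into L.toHomeomorph N (f (Rechart.out L.toHomeomorph M z))) :=
    (contMDiff_into L N).comp (hf.comp (contMDiff_out L M))
  -- (1) `e_M⁻¹ (f^* x) = f^*_dR c`
  have h1 : (e M k).symm (singularCohomology.map ℂ ℂ ⟨f, hf.continuous⟩ k x) =
      complexDeRhamCohomology.map E hf k c := by
    rw [LinearEquiv.symm_apply_eq, hx]
    exact (he M N f hf k c).symm
  -- (2) `out_M^* ∘ f^* = f_L^* ∘ out_N^*` on de Rham cohomology
  have h2 : complexDeRhamCohomology.map E' (contMDiff_out L M) k (complexDeRhamCohomology.map E hf k c) =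
      complexDeRhamCohomology.map E' hfL k (complexDeRhamCohomology.map E' (contMDiff_out L N) k c) := by
    rw [← LinearMap.comp_apply, ← complexDeRhamCohomology.map_comp hf (contMDiff_out L M),
      ← LinearMap.comp_apply, ← complexDeRhamCohomology.map_comp (contMDiff_out L N) hfL]
    rfl
  -- (3) naturality of `e'` along `f_L`
  have h3 := he' (Rechart L.toHomeomorph M) (Rechart L.toHomeomorph N) _ hfL k
    (complexDeRhamCohomology.map E' (contMDiff_out L N) k c)
  -- (4) `into_M^* ∘ f_L^* = f^* ∘ into_N^*` on singular cohomology
  have h4 : (⟨fun z ↦ Rechart.into L.toHomeomorph N (f (Rechart.out L.toHomeomorph M z)),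
        hfL.continuous⟩ : C(Rechart L.toHomeomorph M, Rechart L.toHomeomorph N)).comp
        ⟨Rechart.into L.toHomeomorph M, Rechart.continuous_into _ _⟩ =
      (⟨Rechart.into L.toHomeomorph N, Rechart.continuous_into _ _⟩ : C(N, _)).comp
        ⟨f, hf.continuous⟩ := rfl
  rw [transportEndo_apply, transportEndo_apply, h1, h2, h3, ← ModuleCat.comp_apply,
    ← Literature.AlgebraicTopology.SingularHomology.singularCohomology.map_comp, h4,
    Literature.AlgebraicTopology.SingularHomology.singularCohomology.map_comp, ModuleCat.comp_apply]

/-- The transported endomorphisms form a natural endomorphism of `Hᵏ(-; ℂ)` on `E`-manifolds.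
[folklore] -/
def transportNatEndo (he : e.IsNatural) (he' : e'.IsNatural) : NaturalCohomologyEndo E ℂ k where
  app N _ _ _ _ _ := transportEndo L e e' k N
  naturality M _ _ _ _ _ N _ _ _ _ _ f hf x := transportEndo_naturality L k he he' M N f hf x

end Transport

attribute [local instance] isManifold_rechart

/-! ### The discharge -/

/-- **Discharge of `NaturalDeRhamComparisonRigidity`.** Two natural complex de Rham comparison
families, read on a compact manifold through a diffeomorphism `h : M ≃ M'`, differ in each degree
by a scalar (module docstring: transport along the differential of `h` at a point and
`Literature.Geometry.Manifold.NaturalCohomologyEndo.exists_eq_smul`). [cite: Milnor1963, Thm. 3.5 and §5]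
[cite: HatcherAT2002, §3.1 Thm. 3.2] -/
theorem NaturalDeRhamComparisonRigidity_holds : NaturalDeRhamComparisonRigidity := by
  intro E _ _ _ E' _ _ _ e he e' he' M _ _ _ _ _ _ M' _ _ _ _ _ _ _ h hh hh' k
  rcases isEmpty_or_nonempty M with hM | ⟨⟨x₀⟩⟩
  · refine ⟨0, fun y ↦ ?_⟩
    haveI := ModuleCat.subsingleton_of_isZero
      (Literature.AlgebraicTopology.SingularHomology.isZero_singularCohomology_of_isEmpty
        (R := ℂ) (Y := M) k)
    exact Subsingleton.elim _ _
  -- the differential of `h` at `x₀`: a real linear isomorphism `E ≃L[ℝ] E'`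
  let Φ : M ≃ₘ^∞⟮𝓘(ℝ, E), 𝓘(ℝ, E')⟯ M' := ⟨h.toEquiv, hh, hh'⟩
  let L : E ≃L[ℝ] E' := Φ.mfderivToContinuousLinearEquiv (by simp) x₀
  -- rigidity of the transported natural endomorphism
  obtain ⟨r, hr⟩ := (transportNatEndo L k he he').exists_eq_smul
  refine ⟨r, fun y ↦ ?_⟩
  have hψ := hr M (e M k (complexDeRhamCohomology.map E hh k y))
  change transportEndo L e e' k M (e M k (complexDeRhamCohomology.map E hh k y)) = _ at hψ
  rw [← hψ, transportEndo_apply, LinearEquiv.symm_apply_apply]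
  -- `out^* ∘ h^* = (h ∘ out)^*` on de Rham cohomology, then naturality of `e'` along `h ∘ out`
  rw [← LinearMap.comp_apply, ← complexDeRhamCohomology.map_comp hh (contMDiff_out L M),
    he' (Rechart L.toHomeomorph M) M' _ (hh.comp (contMDiff_out L M)) k y, ← ModuleCat.comp_apply,
    ← Literature.AlgebraicTopology.SingularHomology.singularCohomology.map_comp]
  rfl

/-- **Discharge of the hub fact `hodgePQ_independent_of_hodgeModel`** (`HodgeFiltrationModels.lean`;
Voisin 2002, §7.3.2 with Serre's GAGA uniqueness of the analytification): for a smooth projective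
`X / ℂ`, whether the pull-back of `c ∈ Hᵏ(X(ℂ); ℂ)` lies in `H^{p,q}` does not depend on the Hodge
model. The reduction `hodgePQ_independent_of_hodgeModel_of_naturalDeRhamComparisonRigidity` fed
with `NaturalDeRhamComparisonRigidity_holds`. [cite: VoisinHodgeI2002, §7.3.2] -/
theorem hodgePQ_independent_of_hodgeModel_holds : hodgePQ_independent_of_hodgeModel :=
  hodgePQ_independent_of_hodgeModel_of_naturalDeRhamComparisonRigidity
    NaturalDeRhamComparisonRigidity_holds

end Literature.AlgebraicGeometry.HodgeTheory
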